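import Mathlib
import Summits.Ventures.PercRepro2.HCov
import Summits.Ventures.PercRepro2.A3RootEdge
import Summits.Ventures.PercRepro2.A3RootEdgeMain
import Summits.Ventures.PercRepro2.EdgeCubic

/-!
# Row 2′CPOLAR at the root edges: the two Bernstein coefficients of `Gc` at an edge `{a₁, a₃}` are
the predecessor's signed pieces (blind cell PercRepro2, p5 g14; `proofs/P5-OEDGE.md` §11)

At `p₁ = p[e↦1]` with `ends e = s(a₁, a₃)` the worlds `PD` and `T` are null and `T′ = Q`
(A3RootEdge: `prob_one_PD_inter`, `prob_one_T_inter`, `prob_one_T'_inter`).  Substituting into the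
polarised forms of EdgeCubic.lean gives

* **`B2_eq_root`**: `B2 = D₀ · g₁`, with `g₁ = −2[Q₁(P₁(Q,bL,oH) − P₁(Q,bH,oH)) − (P₁(Q,bL) − P₁(Q,bH))·P₁(Q,oH)]`
  the BHK piece of `g1_nonneg` — hence **`B2_nonneg_root : 0 ≤ B2`** unconditionally;
* **`B1_eq_root`**: `Q₀·Q₁·B1 = Q₁²·Gc p₀ + D₀·Q₀²·g₁ + df·dg`, with `df`, `dg` the cleared factors of
  `dfc_nonneg` / `dgc_nonneg` — hence **`B1_nonneg_root : HCov p₀ → 0 ≤ B1`** (when `Q₀ Q₁ = 0`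
  every term of `B1` vanishes, `B1_eq_zero_of_Q_eq_zero`).

So along a root edge all three Bernstein coefficients `b₀ = Gc p₀`, `b₁`, `b₂` of `Gc` are nonnegative as
soon as (HCOV) holds at `p[e↦0]` (and `b₃ = Gc p₁ = 0`): row 2′CPOLAR holds at every a₃–root edge
given (HCOV) on the deleted instance — the Bernstein reading of `HCov_of_update_zero`
(A3RootEdgeMain), which `EdgeLine.HCov_of_update_zero_of_bern` then reproduces.  The a₂-root edges
follow by the root swap of the statement (`HCov_swap`), not written here.
-/

namespace Summit.Ventures.PercRepro2

open UnionCluster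

namespace CovForm

namespace RootEdge

open CCT EdgeLine

section Bern

variable {V : Type*} {E : Type*} [Fintype V] [DecidableEq V] [Fintype E] [DecidableEq E]
  {R : Type*} [Field R] [LinearOrder R] [IsStrictOrderedRing R]

variable {ends : E → Sym2 V} {e : E} {a₁ a₃ : V}

omit [Fintype V] [DecidableEq V] in
/-- **`B2` at a root edge is `D₀ · g₁`.** -/
theorem B2_eq_root (p : E → R) (hends : ends e = s(a₁, a₃)) (o a₂ b : V) :
    B2 p ends o a₁ a₂ a₃ b e =
      prob (Function.update p e 0) (PDEvent ends a₁ a₂ a₃) *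
        (-2 * (prob (Function.update p e 1) (avoidAll ends a₂ {a₁}) *
          (prob (Function.update p e 1) (avoidAll ends a₂ {a₁} ∩ (connEvent ends a₂ o ∩ connEvent ends a₁ b)) -
            prob (Function.update p e 1) (avoidAll ends a₂ {a₁} ∩ (connEvent ends a₂ o ∩ connEvent ends a₂ b))) -
        (prob (Function.update p e 1) (avoidAll ends a₂ {a₁} ∩ connEvent ends a₁ b) -
            prob (Function.update p e 1) (avoidAll ends a₂ {a₁} ∩ connEvent ends a₂ b)) *
          prob (Function.update p e 1) (avoidAll ends a₂ {a₁} ∩ connEvent ends a₂ o))) := by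
  unfold B2 B2Poly polar2 EQbo EQb3 EQb3o EQo EQ3 EQ3o PDb PDbo Do
  rw [gap_eq_Q (Function.update p e 1), gap_eq_Q (Function.update p e 0)]
  simp only [prob_one_PD_inter p hends a₂, prob_one_T_inter p hends a₂,
    prob_one_T'_inter p hends a₂, prob_one_PD p hends a₂, prob_one_T p hends a₂,
    prob_one_T' p hends a₂]
  ring

/-- **`0 ≤ B2` at a root edge**, unconditionally (`g1_nonneg` at `p[e↦1]` and `D₀ ≥ 0`). -/
theorem B2_nonneg_root (p : E → R) (hp : IsProbVec p) (hends : ends e = s(a₁, a₃)) (o a₂ b : V) :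
    0 ≤ B2 p ends o a₁ a₂ a₃ b e := by
  rw [B2_eq_root p hends o a₂ b]
  have hp₀ : IsProbVec (Function.update p e 0) := hp.update e le_rfl zero_le_one
  have hp₁ : IsProbVec (Function.update p e 1) := hp.update e zero_le_one le_rfl
  exact mul_nonneg (prob_nonneg hp₀ _) (g1_nonneg (Function.update p e 1) hp₁ ends o a₁ a₂ b)

omit [Fintype V] [DecidableEq V] in
/-- **`B1` at a root edge**: `Q₀·Q₁·B1 = Q₁²·Gc p₀ + D₀·Q₀²·g₁ + df·dg` (the Bernstein reading of
`key_identity`). -/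
theorem B1_eq_root (p : E → R) (hends : ends e = s(a₁, a₃)) (o a₂ b : V) :
    prob (Function.update p e 0) (avoidAll ends a₂ {a₁}) *
        prob (Function.update p e 1) (avoidAll ends a₂ {a₁}) * B1 p ends o a₁ a₂ a₃ b e =
      prob (Function.update p e 1) (avoidAll ends a₂ {a₁}) ^ 2 *
          Gc (Function.update p e 0) ends o a₁ a₂ a₃ b +
        prob (Function.update p e 0) (PDEvent ends a₁ a₂ a₃) *
          prob (Function.update p e 0) (avoidAll ends a₂ {a₁}) ^ 2 *
          (-2 * (prob (Function.update p e 1) (avoidAll ends a₂ {a₁}) *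
            (prob (Function.update p e 1)
                (avoidAll ends a₂ {a₁} ∩ (connEvent ends a₂ o ∩ connEvent ends a₁ b)) -
              prob (Function.update p e 1)
                (avoidAll ends a₂ {a₁} ∩ (connEvent ends a₂ o ∩ connEvent ends a₂ b))) -
          (prob (Function.update p e 1) (avoidAll ends a₂ {a₁} ∩ connEvent ends a₁ b) -
              prob (Function.update p e 1) (avoidAll ends a₂ {a₁} ∩ connEvent ends a₂ b)) *
            prob (Function.update p e 1) (avoidAll ends a₂ {a₁} ∩ connEvent ends a₂ o))) +
        (prob (Function.update p e 0) (avoidAll ends a₂ {a₁}) *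
            (prob (Function.update p e 1) (avoidAll ends a₂ {a₁} ∩ connEvent ends a₁ b) -
              prob (Function.update p e 1) (avoidAll ends a₂ {a₁} ∩ connEvent ends a₂ b)) -
          prob (Function.update p e 1) (avoidAll ends a₂ {a₁}) *
            (prob (Function.update p e 0) (avoidAll ends a₂ {a₁} ∩ connEvent ends a₁ b) -
              prob (Function.update p e 0) (avoidAll ends a₂ {a₁} ∩ connEvent ends a₂ b))) *
        (Do (Function.update p e 0) ends o a₁ a₂ a₃ *
              prob (Function.update p e 0) (avoidAll ends a₂ {a₁}) *
              prob (Function.update p e 1) (avoidAll ends a₂ {a₁}) -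
            2 * prob (Function.update p e 1) (avoidAll ends a₂ {a₁} ∩ connEvent ends a₂ o) *
              prob (Function.update p e 0) (PDEvent ends a₁ a₂ a₃) *
              prob (Function.update p e 0) (avoidAll ends a₂ {a₁}) -
            DEF (Function.update p e 0) ends o a₁ a₂ a₃ *
              prob (Function.update p e 1) (avoidAll ends a₂ {a₁})) := by
  unfold B1 B1Poly polar1 Gc DEF EQbo EQb3 EQb3o EQo EQ3 EQ3o PDb PDbo Do
  rw [gap_eq_Q (Function.update p e 1), gap_eq_Q (Function.update p e 0)]
  simp only [prob_one_PD_inter p hends a₂, prob_one_T_inter p hends a₂,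
    prob_one_T'_inter p hends a₂, prob_one_PD p hends a₂, prob_one_T p hends a₂,
    prob_one_T' p hends a₂]
  ring

omit [Fintype V] [DecidableEq V] in
/-- When `Q₀ = 0` or `Q₁ = 0` every term of `B1` vanishes at a root edge. -/
theorem B1_eq_zero_of_Q_eq_zero (p : E → R) (hp : IsProbVec p) (hends : ends e = s(a₁, a₃))
    (o a₂ b : V)
    (hQ : prob (Function.update p e 0) (avoidAll ends a₂ {a₁}) = 0 ∨
      prob (Function.update p e 1) (avoidAll ends a₂ {a₁}) = 0) :
    B1 p ends o a₁ a₂ a₃ b e = 0 := by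
  have hp₀ : IsProbVec (Function.update p e 0) := hp.update e le_rfl zero_le_one
  have hp₁ : IsProbVec (Function.update p e 1) := hp.update e zero_le_one le_rfl
  -- every mass of a sub-event of `Q` at `p_k` is squeezed to `0` when `Q` is null there
  have sub0 : ∀ X : Set (Config E), prob (Function.update p e 0) (avoidAll ends a₂ {a₁}) = 0 →
      prob (Function.update p e 0) (avoidAll ends a₂ {a₁} ∩ X) = 0 := fun X h =>
    le_antisymm (le_trans (prob_mono hp₀ Set.inter_subset_left) h.le) (prob_nonneg hp₀ _)
  have sub1 : ∀ X : Set (Config E), prob (Function.update p e 1) (avoidAll ends a₂ {a₁}) = 0 →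
      prob (Function.update p e 1) (avoidAll ends a₂ {a₁} ∩ X) = 0 := fun X h =>
    le_antisymm (le_trans (prob_mono hp₁ Set.inter_subset_left) h.le) (prob_nonneg hp₁ _)
  have PD0 : ∀ X : Set (Config E), prob (Function.update p e 0) (avoidAll ends a₂ {a₁}) = 0 →
      prob (Function.update p e 0) (PDEvent ends a₁ a₂ a₃ ∩ X) = 0 := fun X h => by
    refine le_antisymm (le_trans (prob_mono hp₀ ?_) h.le) (prob_nonneg hp₀ _)
    intro ω hω
    simp only [Set.mem_inter_iff, PDEvent, Set.mem_compl_iff, mem_connEvent] at hω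
    simp only [mem_avoidAll, Finset.mem_singleton, forall_eq]
    exact fun hc => hω.1.1 (conn_symm hc)
  have T0 : ∀ X : Set (Config E), prob (Function.update p e 0) (avoidAll ends a₂ {a₁}) = 0 →
      prob (Function.update p e 0) (TEvent ends a₁ a₂ a₃ ∩ X) = 0 := fun X h => by
    refine le_antisymm (le_trans (prob_mono hp₀ ?_) h.le) (prob_nonneg hp₀ _)
    intro ω hω
    simp only [Set.mem_inter_iff, TEvent, Set.mem_compl_iff, mem_connEvent] at hω
    simp only [mem_avoidAll, Finset.mem_singleton, forall_eq]
    exact hω.1.1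
  have T'0 : ∀ X : Set (Config E), prob (Function.update p e 0) (avoidAll ends a₂ {a₁}) = 0 →
      prob (Function.update p e 0) (TEvent ends a₂ a₁ a₃ ∩ X) = 0 := fun X h => by
    refine le_antisymm (le_trans (prob_mono hp₀ ?_) h.le) (prob_nonneg hp₀ _)
    intro ω hω
    simp only [Set.mem_inter_iff, TEvent, Set.mem_compl_iff, mem_connEvent] at hω
    simp only [mem_avoidAll, Finset.mem_singleton, forall_eq]
    exact fun hc => hω.1.1 (conn_symm hc)
  unfold B1 B1Poly polar1 EQbo EQb3 EQb3o EQo EQ3 EQ3o PDb PDbo Do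
  rw [gap_eq_Q (Function.update p e 1), gap_eq_Q (Function.update p e 0)]
  simp only [prob_one_PD_inter p hends a₂, prob_one_T_inter p hends a₂,
    prob_one_T'_inter p hends a₂, prob_one_PD p hends a₂, prob_one_T p hends a₂,
    prob_one_T' p hends a₂]
  rcases hQ with h | h
  · have hPD : prob (Function.update p e 0) (PDEvent ends a₁ a₂ a₃) = 0 := by
      simpa only [Set.inter_univ] using PD0 Set.univ h
    simp only [sub0 _ h, PD0 _ h, T0 _ h, T'0 _ h, hPD, h]
    ring
  · simp only [sub1 _ h, h]
    ring

/-- **`0 ≤ B1` at a root edge, given (HCOV) at `p[e↦0]`** (the Bernstein reading of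
`HCov_of_update_zero`). -/
theorem B1_nonneg_root (p : E → R) (hp : IsProbVec p) (hends : ends e = s(a₁, a₃)) (o a₂ b : V)
    (h₀ : HCov (Function.update p e 0) ends o a₁ a₂ a₃ b) : 0 ≤ B1 p ends o a₁ a₂ a₃ b e := by
  have hp₀ : IsProbVec (Function.update p e 0) := hp.update e le_rfl zero_le_one
  have hp₁ : IsProbVec (Function.update p e 1) := hp.update e zero_le_one le_rfl
  have hQ0 := prob_nonneg hp₀ (avoidAll ends a₂ {a₁})
  have hQ1 := prob_nonneg hp₁ (avoidAll ends a₂ {a₁})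
  rcases eq_or_lt_of_le hQ0 with hz | hpos0
  · rw [B1_eq_zero_of_Q_eq_zero p hp hends o a₂ b (Or.inl hz.symm)]
  rcases eq_or_lt_of_le hQ1 with hz | hpos1
  · rw [B1_eq_zero_of_Q_eq_zero p hp hends o a₂ b (Or.inr hz.symm)]
  have key := B1_eq_root p hends o a₂ b
  have hg := g1_nonneg (Function.update p e 1) hp₁ ends o a₁ a₂ b
  have hdf := dfc_nonneg p hp ends a₁ a₂ a₃ b e hends
  have hdg := dgc_nonneg p hp ends o a₁ a₂ a₃ e hends
  have hD := prob_nonneg hp₀ (PDEvent ends a₁ a₂ a₃)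
  unfold HCov at h₀
  have hrhs : 0 ≤ prob (Function.update p e 0) (avoidAll ends a₂ {a₁}) *
      prob (Function.update p e 1) (avoidAll ends a₂ {a₁}) * B1 p ends o a₁ a₂ a₃ b e := by
    rw [key]
    refine add_nonneg (add_nonneg ?_ ?_) ?_
    · exact mul_nonneg (pow_nonneg hQ1 2) h₀
    · exact mul_nonneg (mul_nonneg hD (pow_nonneg hQ0 2)) hg
    · exact mul_nonneg hdf hdg
  exact le_of_mul_le_mul_left (by rw [mul_zero]; exact hrhs) (mul_pos hpos0 hpos1)

end Bern

end RootEdge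

end CovForm

end Summit.Ventures.PercRepro2
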